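import Summits.QuantumFields.YangMills.Theorems.BalabanUVNodesN15KingModelCurvedKnitFlat
import Summits.QuantumFields.YangMills.Theorems.BalabanUVNodesN15CurvedDressedPairDefectKingTorusUN
import HarnessLib

/-!
# Route «BalabanUVNodes» (cluster K4 «SpineRates»), Track-A DAG node N15 = NE2 — PART Ω-f: THE KING INHABITANT OF dag-n15-w3's CURVED KNIT WITH A **NON-CONSTANT** PERTURBATION
# GENERATOR FIELD (dag-n15-e's Ω-c with the constant `Zc` replaced by a field `Z′` carrying the (3.35)∕(3.36)-shaped letters `r, g, G₂`), AND ITS `𝔲(N)` EDITION: King's `A = 0`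
# propagator dressed by `Ad(e^{η′A′(x)})` for a small, slowly varying skew-Hermitian lattice gauge field `A′`, letters ON THE POTENTIAL

Cell `pub-ymgap`, WIDTH SEAT `pub-ymgap-dag-n15-w2` (director-ym №197 ∕ HUMAN RULING D-0149), generation 3, file 4.  `bears_on: R4∕N15 · K3⁷ SpineGivenEndpointR13SepCoPH
(stmt-QuantumFields-20544)`.  Filed `--kind proof --supports stmt-QuantumFields-20544 --as helper` — COUNT-NEUTRAL; theorems only (0 `def`, 0 `sorry`, 0 `instance`; Mathlib's SCOPED
Frobenius structure on `M_N(ℂ)`).  Imports BY NAME dag-n15-e g14's PART Ω-c `…N15KingModelCurvedKnitFlat` (p598752: `hasMaj_idef_curvDressed_kingTorus_king`'s OBJECTS and Ω-b's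
`kingFullProp_uniform_layer_backward`, `covPieces_flat_*`, `castT`, `idef_conj_eq`, `hasMaj_conjEquiv`, `hasMaj_pullEquiv_comp`, `blockOf_comp_blockOf_eq`) and this seat's g2 file 6
`…N15CurvedDressedPairDefectKingTorusUN` (p599926; through it file 3 p595427 `coordMat_adCLM_transpose_eq_neg_of_conjTranspose`, n15-b `adCLM_sub`, b2b `adCLM`, `norm_adCLM_le`,
`adCLM_smul`); dag-n15-w3's knit `hasMaj_idef_curvDressed_kingTorus` (p595387) BY NAME; nothing re-declared.

WHY.  dag-n15-e's PART Ω-c inhabits the curved knit with King's propagator at a CONSTANT generator `Zc` (so every fine-field gradient letter is `0`); PART Ω-d and this seat's file 1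
(`…KingModelCurvedKnitInstancesUN`) gave the trivial, the U(1) and the constant-`𝔲(N)` data.  In [Balaban1985BackgroundPropagators] (3.35)–(3.37) p. 396 the perturbation field
`A′` VARIES over the lattice, with `|A′|, |∇A′|, |∇∇A′|` small — the knit p595387 carries exactly these letters (`r`, `η′g`, `η′G₂`) for a generator FIELD.  Ω-c's discharge of the
inductive datum (Ω-b's nine letters at the flat base point `W′ = 0`) does not touch the perturbation field, so the SAME proof inhabits the knit for a non-constant `Z′`: THIS FILE
does that (§1, proof = Ω-c's verbatim with `Zc ↦ Z′`, the letters `g, G₂` live), and reads it for the programme's fibre (§2): `𝔄 = M_N(ℂ)`, `Z′ = ad ∘ A′` with `A′` skew-Hermitian,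
letters ON THE POTENTIAL (`‖A′‖ ≤ a₀`, `‖A′(y′) − A′(y′ − e_ν)‖ ≤ η′g_A`, second differences `≤ η′G_A`) through `‖ad_X‖ ≤ 2‖X‖` and the linearity of `ad` — King's propagator dressed
by the x-DEPENDENT non-abelian transporter `Ad(e^{η′A′(x)})`.

WHAT: §1 ★★ `hasMaj_idef_curvDressed_kingTorus_king_field` (general `𝔄`, field `Z′`, letters `r ≤ 1`, `g`, `G₂`, skew coordinates, Neumann smallness at `R_V(r, 0, g)`; majorant
= p595387's at `r_B = g_B = 0`); §2 ★★ `uN_hasMaj_idef_curvDressed_kingTorus_king_field` (`𝔄 = M_N(ℂ)`, trace-form-orthonormal `e`, `Z′ = ad ∘ A′`, `(A′)ᴴ = −A′`: displayed only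
the potential's three letters, `2a₀ ≤ 1`, `he`, and the smallness at `R_V(2a₀, 0, 2g_A)`).

HONEST FRAMING ∕ LIMITS.  Ω-c's proof re-run + letter bookkeeping; King's `A = 0` propagator at the FLAT base point (`W′ = 0`) dressed by a NON-CONSTANT but LINEARISED transporter
(coarse generator = block mean of the fine one — the lineage's model of the averaging, not (3.8)); a positive control ∕ non-vacuity certificate, NOT an estimate of Bałaban's
`G(U)`, NOT a curved base point, NOT the (C3) transport; nothing of [B6]∕[B9] asserted ((3.35)–(3.37) p. 396, (3.50) p. 400, Thm 3.1 (3.42) p. 397, (3.63)–(3.65) pp. 402–403 cited as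
SHAPES ∕ MECHANISM).  NE2⁺ NOT PRINTED ∕ NOT proved for d = 4; N15 NOT discharged; K3⁷ OPEN; counts UNMOVED (typed 28∕28 · discharged 5∕27, A 5∕28); one finite 𝕋⁴ at fixed
ε — NOT infinite volume, NOT OS on ℝ⁴, NOT a mass gap, NOT Clay; R4 closes the conditional finite-𝕋⁴ rung `BalabanLadder.UV` only.  Restate-immune (no Theses import).
-/

set_option autoImplicit false

noncomputable section
open scoped BigOperators Matrix Matrix.Norms.Frobenius

namespace Summit.QuantumFields.YangMills.BalabanUVNodes.N15.CurvedSpecies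

open Real Finset NormedSpace
open Literature.MathematicalPhysics.QuantumFieldTheory.Balaban1983to89
open Literature.MathematicalPhysics.QuantumFieldTheory.Balaban1983to89.B11SectG (BlockNorm HasMaj RowSum)
open Literature.MathematicalPhysics.QuantumFieldTheory.Balaban1983to89.B6RandomWalk (Triangle254)
open Literature.MathematicalPhysics.QuantumFieldTheory.Balaban1983to89.B6UnitTorusCarrier (unitTorusGeo triangle254_unitTorusGeo rowSum_unitTorusGeo)
open Literature.MathematicalPhysics.QuantumFieldTheory.Balaban1983to89.T4EtaRateDefect (idef idef_apply idef_comp)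
open Literature.MathematicalPhysics.QuantumFieldTheory.Balaban1983to89.T4EtaRateCoeffDefect (pull pull_apply)
open Literature.MathematicalPhysics.QuantumFieldTheory.Balaban1983to89.B5Prop11Plancherel (Tor fine unitVec)
open Literature.MathematicalPhysics.QuantumFieldTheory.King1986 (aK)
open Literature.MathematicalPhysics.QuantumFieldTheory.King1986.Torus (fineOp blockOf tdistT tdistT_nonneg)
open Literature.MathematicalPhysics.QuantumFieldTheory.Balaban1983to89.Beta.AveragingCorrectionJets (adCLM norm_adCLM_le adCLM_smul)
open Literature.Barriers.QuantumFields (traceForm)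
open Summit.QuantumFields.YangMills.BalabanUVNodes.N15.VectorPiece (unitTorusGeoS tensorId tensorId_apply hasMaj_tensorId idef_tensorId)
open Summit.QuantumFields.YangMills.BalabanUVNodes.N15.MatrixSpecies (liftMap liftBlk liftEquiv liftEquiv_apply liftEquiv_symm_apply coordMat coordMat_sub basisConst
  basisConst_nonneg Phi0 adCLM_sub)
open Summit.QuantumFields.YangMills.BalabanUVNodes.N15.BackgroundLayer (fgrad bgrad liftPair blkPair coordMat_smul coordMat_one)
open Summit.QuantumFields.YangMills.BalabanUVNodes.N15KingModelRung.Curved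

variable {d : ℕ} (L : ℕ)

/-! ## §1 The knit with a non-constant perturbation generator field -/

section Field

variable [NeZero L]

/-- ★★ **PART Ω-f — THE KING INHABITANT OF THE CURVED KNIT WITH A NON-CONSTANT PERTURBATION GENERATOR FIELD** (dag-n15-e's Ω-c `hasMaj_idef_curvDressed_kingTorus_king`, proof
VERBATIM, the constant `Zc` replaced by a FIELD `Z′` on the fine torus).  For odd `L ≥ 3`, `a > 0`, `m₀² ≥ 0`, `0 < γ < 1`, `0 < α < 1` there are `β, δ, m > 0` such that for every
`K ≥ 1`, cube `2L^e`, mass `0 < m² ≤ m₀²`, `Msz`, every coordinate system `e : 𝔄 ≃ ℝ^ι` of a complete normed ℝ-algebra and every generator FIELD `Z′` with the (3.35)∕(3.36)-SHAPED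
letters `‖Z′‖ ≤ r ≤ 1`, `‖Z′_μ(y′) − Z′_μ(y′ − e_ν)‖ ≤ η′g`, second differences `≤ η′G₂` (`η′ = L^{−(K+1)}`) and SKEW coordinate matrices, under dag-n15-w3's Neumann smallness at
the row letter `R_V(r, 0, g)`: the η-defect of the dressed pairs of King's full `A = 0` propagator — dressed by `e^{η′Z′}` on the fine torus, by `e^{ηZ̄′}` (block mean) on the coarse one,
FLAT base point `W′ = 0` — is majorised by p595387's majorant at `r_B = g_B = 0` (the inductive datum = Ω-b's nine letters, every carrier∕regime letter a theorem of the rung).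
[cite: Balaban1985BackgroundPropagators, (3.35)–(3.37) p.396, Thm 3.1 (3.42)–(3.43) pp.397–398, (3.52)–(3.53) p.400, (3.63)–(3.65) pp.402–403 (shapes, mechanism); King1986, (2.13)–(2.17) p.653, Thm 3.3 p.655, (3.7)–(3.8) p.656, p.664, Prop. 3.9 (3.73) p.665; Balaban1983RegularityDecay, (1.9)–(1.10) p.573] -/
theorem hasMaj_idef_curvDressed_kingTorus_king_field (hLodd : Odd L) (hL : 2 ≤ L) {a : ℝ} (ha : 0 < a) {m0sq : ℝ} (hm0 : 0 ≤ m0sq) {γ : ℝ} (hγ0 : 0 < γ)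
    (hγ1 : γ < 1) {α : ℝ} (hα0 : 0 < α) (hα1 : α < 1) :
    ∃ β δ m : ℝ, 0 < β ∧ 0 < δ ∧ 0 < m ∧ ∀ (K : ℕ), 1 ≤ K → ∀ (e : ℕ) (M : Fin (d + 1) → ℕ) [∀ μ, NeZero (M μ)], (∀ μ, M μ = 2 * L ^ e) →
      ∀ (msq : ℝ), 0 < msq → msq ≤ m0sq → ∀ (Msz : ℝ)
      (ι : Type) [Fintype ι] [DecidableEq ι] (𝔄 : Type) [NormedRing 𝔄] [NormedAlgebra ℝ 𝔄] [CompleteSpace 𝔄] (eB : 𝔄 ≃L[ℝ] (ι → ℝ))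
      (Z' : Fin (d + 1) → Tor (fine L (fine (L ^ K) M)) → (𝔄 →L[ℝ] 𝔄)) (r g G₂ : ℝ), 0 ≤ r → r ≤ 1 → 0 ≤ g → 0 ≤ G₂ → (∀ μ y', ‖Z' μ y'‖ ≤ r) →
      (∀ μ ν y', ‖Z' μ y' - Z' μ (y' - unitVec (fine L (fine (L ^ K) M)) ν)‖ ≤ ((L : ℝ) ^ (K + 1))⁻¹ * g) →
      (∀ μ ν (z' : Tor (fine L (fine (L ^ K) M))), ‖(((L : ℝ) ^ (K + 1))⁻¹)⁻¹ • (Z' μ (z' + unitVec (fine L (fine (L ^ K) M)) ν + unitVec (fine L (fine (L ^ K) M)) μ) -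
          Z' μ (z' + unitVec (fine L (fine (L ^ K) M)) ν)) - (((L : ℝ) ^ (K + 1))⁻¹)⁻¹ • (Z' μ (z' + unitVec (fine L (fine (L ^ K) M)) μ) - Z' μ z')‖ ≤ ((L : ℝ) ^ (K + 1))⁻¹ * G₂) →
      (∀ μ y', (coordMat eB (Z' μ y'))ᵀ = -coordMat eB (Z' μ y')) →
      β * (expRowLetter ι (Fin (d + 1)) (basisConst eB) r 0 g * (1 + Fintype.card (Fin (d + 1) ⊕ Fin (d + 1)))) * B4Sect5Proof.latticeConst (d + 1) (δ / 2) < 1 →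
    HasMaj (BlockNorm.ofBlocks (unitTorusGeoS L K M Msz) (liftBlk (blockOf (L ^ K) M) ι)) (BlockNorm.ofBlocks (unitTorusGeoS L K M Msz) (blkPair (liftBlk (blockOf (L ^ K) M ∘ blockOf L (fine (L ^ K) M)) ι)))
      (idef (pull (liftMap (blockOf L (fine (L ^ K) M)) ι)) (pull (liftPair (liftMap (blockOf L (fine (L ^ K) M)) ι)))
        (curvDressed ((L : ℝ) ^ (K + 1))⁻¹ (torStep (fine L (fine (L ^ K) M))) (expTrField eB ((L : ℝ) ^ (K + 1))⁻¹ 0) (expTrField eB ((L : ℝ) ^ (K + 1))⁻¹ Z') (kingGT₁ L a msq K M ι))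
        (curvDressed ((L : ℝ) * ((L : ℝ) ^ (K + 1))⁻¹) (torStep (fine (L ^ K) M)) (expTrField eB ((L : ℝ) * ((L : ℝ) ^ (K + 1))⁻¹) (blockMeanField L (fine (L ^ K) M) 0)) (expTrField eB ((L : ℝ) * ((L : ℝ) ^ (K + 1))⁻¹) (blockMeanField L (fine (L ^ K) M) Z')) (kingGT L a msq K M ι)))
      (fun y y' => (m * (((L : ℝ) ^ K) ^ (-(γ / 2)) + ((L : ℝ) ^ K) ^ (-α)) * B4Sect5Proof.latticeConst (d + 1) (δ / 2) + 1 * (m * (((L : ℝ) ^ K) ^ (-(γ / 2)) + ((L : ℝ) ^ K) ^ (-α)) * B4Sect5Proof.latticeConst (d + 1) (δ / 2)) * (expRowLetter ι (Fin (d + 1)) (basisConst eB) r 0 g * (1 + Fintype.card (Fin (d + 1) ⊕ Fin (d + 1))) *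
          (β * (1 - β * (expRowLetter ι (Fin (d + 1)) (basisConst eB) r 0 g * (1 + Fintype.card (Fin (d + 1) ⊕ Fin (d + 1)))) * B4Sect5Proof.latticeConst (d + 1) (δ / 2))⁻¹)) +
          β * (expFitLetter ι (Fin (d + 1)) (basisConst eB) r 0 g (((d + 1 : ℕ) : ℝ) * ((L : ℝ) * ((L : ℝ) ^ (K + 1))⁻¹) * g) (((d + 1 : ℕ) : ℝ) * ((L : ℝ) * ((L : ℝ) ^ (K + 1))⁻¹) * g + (L : ℝ) * ((L : ℝ) ^ (K + 1))⁻¹ * g)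
              (((d + 1 : ℕ) : ℝ) * ((L : ℝ) * ((L : ℝ) ^ (K + 1))⁻¹) * 0 + (L : ℝ) * ((L : ℝ) ^ (K + 1))⁻¹ * 0) ((((d + 1 : ℕ) : ℝ) + 1) * ((L : ℝ) * ((L : ℝ) ^ (K + 1))⁻¹) * G₂) ((L : ℝ) * ((L : ℝ) ^ (K + 1))⁻¹) * (1 + Fintype.card (Fin (d + 1) ⊕ Fin (d + 1)))) *
            (β * (1 - β * (expRowLetter ι (Fin (d + 1)) (basisConst eB) r 0 g * (1 + Fintype.card (Fin (d + 1) ⊕ Fin (d + 1)))) * B4Sect5Proof.latticeConst (d + 1) (δ / 2))⁻¹) * B4Sect5Proof.latticeConst (d + 1) (δ / 2)) *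
        (1 - 1 * (β * (expRowLetter ι (Fin (d + 1)) (basisConst eB) r 0 g * (1 + Fintype.card (Fin (d + 1) ⊕ Fin (d + 1)))) * B4Sect5Proof.latticeConst (d + 1) (δ / 2)))⁻¹ * Real.exp (-(δ / 2 * tdistT M y y'))) := by
  obtain ⟨β, δ, m, hβ, hδ, hm, H⟩ := kingFullProp_uniform_layer_backward (d := d) L hLodd hL ha hm0 hγ0.le hγ1 hα0 hα1
  refine ⟨β, δ, m, hβ, hδ, hm, fun K hK e M _ hM msq hmsq hcap Msz ι _ _ 𝔄 _ _ _ eB Z' r g G₂ hr0 hr1 hg hG₂ hZ' hgrad' hsec' hZs' hq => ?_⟩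
  have hL1 : (1 : ℝ) ≤ (L : ℝ) := by exact_mod_cast (show 1 ≤ L by omega)
  have hL0 : (0 : ℝ) < (L : ℝ) := by positivity
  have hη' : 0 < ((L : ℝ) ^ (K + 1))⁻¹ := by positivity
  have hθ0 : 0 ≤ ((L : ℝ) ^ K) ^ (-(γ / 2)) + ((L : ℝ) ^ K) ^ (-α) :=
    add_nonneg (Real.rpow_nonneg (pow_nonneg hL0.le _) _) (Real.rpow_nonneg (pow_nonneg hL0.le _) _)
  have hmθ : 0 ≤ m * (((L : ℝ) ^ K) ^ (-(γ / 2)) + ((L : ℝ) ^ K) ^ (-α)) := mul_nonneg hm.le hθ0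
  have hηη₀ : (L : ℝ) * ((L : ℝ) ^ (K + 1))⁻¹ ≤ 1 := by
    rw [pow_succ', mul_inv, ← mul_assoc, mul_inv_cancel₀ hL0.ne', one_mul]
    exact inv_le_one_of_one_le₀ (one_le_pow₀ hL1)
  -- the carrier facts
  have hσ : 0 < δ / 2 := half_pos hδ
  have htri : Triangle254 (unitTorusGeoS L K M Msz) := triangle254_unitTorusGeo L K M
  have hd : ∀ a b : (unitTorusGeoS L K M Msz).Site, 0 ≤ (unitTorusGeoS L K M Msz).dist a b := fun a b => tdistT_nonneg M a b
  have hrow : RowSum (unitTorusGeoS L K M Msz) (δ / 2) (B4Sect5Proof.latticeConst (d + 1) (δ / 2)) := rowSum_unitTorusGeo L K M hσ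
  have hcr : 0 ≤ B4Sect5Proof.latticeConst (d + 1) (δ / 2) := B4Sect5Proof.latticeConst_nonneg (d + 1) hσ.le
  -- the nine scalar letters one level up (`n = 1`), their majorants nonnegative
  have HK := fun μ : Fin (d + 1) => H K hK 1 le_rfl e M hM msq hmsq hcap Msz μ
  have maj0 : ∀ y y' : Tor M, 0 ≤ β * Real.exp (-(δ * tdistT M y y')) := fun _ _ => by positivity
  have majm : ∀ y y' : Tor M, 0 ≤ m * (((L : ℝ) ^ K) ^ (-(γ / 2)) + ((L : ℝ) ^ K) ^ (-α)) * Real.exp (-(δ * tdistT M y y')) :=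
    fun _ _ => mul_nonneg hmθ (Real.exp_nonneg _)
  -- (hG) `G = A₀⁻¹ ⊗ 1`
  have hG : HasMaj (BlockNorm.ofBlocks (unitTorusGeoS L K M Msz) (liftBlk (blockOf (L ^ K) M) ι))
      (BlockNorm.ofBlocks (unitTorusGeoS L K M Msz) (liftBlk (blockOf (L ^ K) M) ι)) (kingGT L a msq K M ι)
      (fun y y' => β * Real.exp (-(δ * (unitTorusGeoS L K M Msz).dist y y'))) :=
    hasMaj_tensorId ι maj0 (HK 0).1
  -- (hD) the coarse covariant pieces at the flat point
  have hD : ∀ j, HasMaj (BlockNorm.ofBlocks (unitTorusGeoS L K M Msz) (liftBlk (blockOf (L ^ K) M) ι))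
      (BlockNorm.ofBlocks (unitTorusGeoS L K M Msz) (liftBlk (blockOf (L ^ K) M) ι))
      (covPieces ((L : ℝ) * ((L : ℝ) ^ (K + 1))⁻¹) (torStep (fine (L ^ K) M))
        (gaugePair (torStep (fine (L ^ K) M)) (expTrField eB ((L : ℝ) * ((L : ℝ) ^ (K + 1))⁻¹)
          (blockMeanField L (fine (L ^ K) M) (0 : Fin (d + 1) → Tor (fine L (fine (L ^ K) M)) → (𝔄 →L[ℝ] 𝔄))))) (kingGT L a msq K M ι) j)
      (fun y y' => β * Real.exp (-(δ * (unitTorusGeoS L K M Msz).dist y y'))) := by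
    intro j
    rw [blockMeanField_zero, expTrField_zero, gaugePair_one]
    cases j with
    | inl μ => rw [covPieces_flat_coarse_inl]; exact hasMaj_tensorId ι maj0 (HK μ).2.1
    | inr μ => rw [covPieces_flat_coarse_inr]; exact hasMaj_tensorId ι maj0 (HK μ).2.2.1
  -- (hG′) `G′ = (cast∘A₀′⁻¹∘cast⁻¹) ⊗ 1`
  have hG' : HasMaj (BlockNorm.ofBlocks (unitTorusGeoS L K M Msz) (liftBlk (blockOf (L ^ K) M ∘ blockOf L (fine (L ^ K) M)) ι))
      (BlockNorm.ofBlocks (unitTorusGeoS L K M Msz) (liftBlk (blockOf (L ^ K) M ∘ blockOf L (fine (L ^ K) M)) ι)) (kingGT₁ L a msq K M ι)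
      (fun y y' => β * Real.exp (-(δ * (unitTorusGeoS L K M Msz).dist y y'))) := by
    refine hasMaj_tensorId ι maj0 ?_
    rw [blockOf_comp_blockOf_eq]
    exact hasMaj_conjEquiv _ _ (castT L K M) maj0 (HK 0).2.2.2.1
  -- (hD′) the fine covariant pieces at the flat point
  have hD' : ∀ j, HasMaj (BlockNorm.ofBlocks (unitTorusGeoS L K M Msz) (liftBlk (blockOf (L ^ K) M ∘ blockOf L (fine (L ^ K) M)) ι))
      (BlockNorm.ofBlocks (unitTorusGeoS L K M Msz) (liftBlk (blockOf (L ^ K) M ∘ blockOf L (fine (L ^ K) M)) ι))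
      (covPieces (((L : ℝ) ^ (K + 1))⁻¹) (torStep (fine L (fine (L ^ K) M)))
        (gaugePair (torStep (fine L (fine (L ^ K) M))) (expTrField eB (((L : ℝ) ^ (K + 1))⁻¹)
          (0 : Fin (d + 1) → Tor (fine L (fine (L ^ K) M)) → (𝔄 →L[ℝ] 𝔄)))) (kingGT₁ L a msq K M ι) j)
      (fun y y' => β * Real.exp (-(δ * (unitTorusGeoS L K M Msz).dist y y'))) := by
    intro j
    rw [expTrField_zero, gaugePair_one]
    cases j with
    | inl μ =>
        rw [covPieces_flat_fine_inl]
        refine hasMaj_tensorId ι maj0 ?_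
        rw [blockOf_comp_blockOf_eq]
        exact hasMaj_conjEquiv _ _ (castT L K M) maj0 (HK μ).2.2.2.2.1
    | inr μ =>
        rw [covPieces_flat_fine_inr]
        refine hasMaj_tensorId ι maj0 ?_
        rw [blockOf_comp_blockOf_eq]
        exact hasMaj_conjEquiv _ _ (castT L K M) maj0 (HK μ).2.2.2.2.2.1
  -- (hDG) the two-grid defect of `G`
  have hDG : HasMaj (BlockNorm.ofBlocks (unitTorusGeoS L K M Msz) (liftBlk (blockOf (L ^ K) M) ι))
      (BlockNorm.ofBlocks (unitTorusGeoS L K M Msz) (liftBlk (blockOf (L ^ K) M ∘ blockOf L (fine (L ^ K) M)) ι))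
      (idef (pull (liftMap (blockOf L (fine (L ^ K) M)) ι)) (pull (liftMap (blockOf L (fine (L ^ K) M)) ι)) (kingGT₁ L a msq K M ι) (kingGT L a msq K M ι))
      (fun y y' => m * (((L : ℝ) ^ K) ^ (-(γ / 2)) + ((L : ℝ) ^ K) ^ (-α)) * Real.exp (-(δ * (unitTorusGeoS L K M Msz).dist y y'))) := by
    rw [kingGT₁, kingGT, idef_tensorId]
    refine hasMaj_tensorId ι majm ?_
    rw [kingGOp₁, idef_conj_eq, blockOf_comp_blockOf_eq]
    exact hasMaj_pullEquiv_comp _ (castT L K M) majm (HK 0).2.2.2.2.2.2.1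
  -- (hDD) the two-grid defects of the covariant pieces
  have hDD : ∀ j, HasMaj (BlockNorm.ofBlocks (unitTorusGeoS L K M Msz) (liftBlk (blockOf (L ^ K) M) ι))
      (BlockNorm.ofBlocks (unitTorusGeoS L K M Msz) (liftBlk (blockOf (L ^ K) M ∘ blockOf L (fine (L ^ K) M)) ι))
      (idef (pull (liftMap (blockOf L (fine (L ^ K) M)) ι)) (pull (liftMap (blockOf L (fine (L ^ K) M)) ι))
        (covPieces (((L : ℝ) ^ (K + 1))⁻¹) (torStep (fine L (fine (L ^ K) M)))
          (gaugePair (torStep (fine L (fine (L ^ K) M))) (expTrField eB (((L : ℝ) ^ (K + 1))⁻¹)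
            (0 : Fin (d + 1) → Tor (fine L (fine (L ^ K) M)) → (𝔄 →L[ℝ] 𝔄)))) (kingGT₁ L a msq K M ι) j)
        (covPieces ((L : ℝ) * ((L : ℝ) ^ (K + 1))⁻¹) (torStep (fine (L ^ K) M))
          (gaugePair (torStep (fine (L ^ K) M)) (expTrField eB ((L : ℝ) * ((L : ℝ) ^ (K + 1))⁻¹)
            (blockMeanField L (fine (L ^ K) M) (0 : Fin (d + 1) → Tor (fine L (fine (L ^ K) M)) → (𝔄 →L[ℝ] 𝔄))))) (kingGT L a msq K M ι) j))
      (fun y y' => m * (((L : ℝ) ^ K) ^ (-(γ / 2)) + ((L : ℝ) ^ K) ^ (-α)) * Real.exp (-(δ * (unitTorusGeoS L K M Msz).dist y y'))) := by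
    intro j
    rw [blockMeanField_zero, expTrField_zero, expTrField_zero, gaugePair_one, gaugePair_one]
    cases j with
    | inl μ =>
        rw [covPieces_flat_fine_inl, covPieces_flat_coarse_inl, idef_tensorId]
        refine hasMaj_tensorId ι majm ?_
        rw [idef_conj_eq, blockOf_comp_blockOf_eq]
        exact hasMaj_pullEquiv_comp _ (castT L K M) majm (HK μ).2.2.2.2.2.2.2.1
    | inr μ =>
        rw [covPieces_flat_fine_inr, covPieces_flat_coarse_inr, idef_tensorId]
        refine hasMaj_tensorId ι majm ?_
        rw [idef_conj_eq, blockOf_comp_blockOf_eq]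
        exact hasMaj_pullEquiv_comp _ (castT L K M) majm (HK μ).2.2.2.2.2.2.2.2
  -- the knit
  exact hasMaj_idef_curvDressed_kingTorus L (fine (L ^ K) M) eB (blockOf (L ^ K) M) (((L : ℝ) ^ (K + 1))⁻¹) Z' 0
    (kingGT L a msq K M ι) (kingGT₁ L a msq K M ι) (geo := unitTorusGeoS L K M Msz) (σ := δ / 2) (cr := B4Sect5Proof.latticeConst (d + 1) (δ / 2))
    (ρ := δ / 2) (δ := δ) (β := β) (m := m * (((L : ℝ) ^ K) ^ (-(γ / 2)) + ((L : ℝ) ^ K) ^ (-α))) (η₀ := 1) (r := r) (rB := 0) (g := g) (gB := 0) (G₂ := G₂)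
    htri hd hσ.le hcr hrow hσ.le (by linarith) hβ.le hmθ (by rw [one_mul]; exact hr1) (by norm_num) hη' hηη₀ hr0 le_rfl hg le_rfl hG₂
    hG hD hG' hD' hDG hDD hZ' (fun _ _ => by simp) hgrad' (fun _ _ _ => by simp) hsec'
    hZs' (fun _ _ => by
      have h0 := coordMat_sub eB (0 : 𝔄 →L[ℝ] 𝔄) 0
      rw [sub_self, sub_self] at h0
      rw [Pi.zero_apply, Pi.zero_apply, h0, Matrix.transpose_zero, neg_zero]) hq

end Field

/-! ## §2 The `𝔲(N)` edition: King's propagator dressed by `Ad(e^{η′A′(x)})`, letters on the potential -/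

section Adjoint

variable [NeZero L]
variable {n : Type} [Fintype n] [DecidableEq n] {κ : Type} [Fintype κ] [DecidableEq κ] (e : Matrix n n ℂ ≃L[ℝ] (κ → ℝ))

/-- ★★ **KING's PROPAGATOR DRESSED BY A SMALL, SLOWLY VARYING `𝔲(N)`-VALUED GAUGE FIELD IN THE ADJOINT REPRESENTATION.**  §1 at `𝔄 = M_N(ℂ)` (Frobenius ∕ trace-form norm),
`ι = κ`, `eB = e` trace-form-orthonormal (`he`), `Z′ = ad ∘ A′` for a skew-Hermitian lattice gauge field `A′` on the fine torus with the (3.35)∕(3.36)-SHAPED letters ON THE POTENTIAL: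
`‖A′_μ(y′)‖ ≤ a₀` (`2a₀ ≤ 1`), `‖A′_μ(y′) − A′_μ(y′ − e_ν)‖ ≤ η′g_A`, second differences `≤ η′G_A` — generator letters `2a₀, 2g_A, 2G_A` by `‖ad_X‖ ≤ 2‖X‖` and the linearity of `ad`,
skewness by file 3's `coordMat_adCLM_transpose_eq_neg_of_conjTranspose`.  Displayed: the potential's letters, `he`, and the Neumann smallness at `R_V(2a₀, 0, 2g_A)`.
[cite: Balaban1985BackgroundPropagators, (3.35)–(3.37) p.396, (3.50) p.400 (adjoint transporter, small-field letters: shapes), Thm 3.1 (3.42) p.397, (3.63)–(3.65) pp.402–403 (mechanism); King1986, (2.13)–(2.17) p.653, Prop. 3.9 (3.73) p.665 (template)] -/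
theorem uN_hasMaj_idef_curvDressed_kingTorus_king_field (he : ∀ X Y : Matrix n n ℂ, traceForm X Y = e X ⬝ᵥ e Y) (hLodd : Odd L) (hL : 2 ≤ L) {a : ℝ} (ha : 0 < a)
    {m0sq : ℝ} (hm0 : 0 ≤ m0sq) {γ : ℝ} (hγ0 : 0 < γ) (hγ1 : γ < 1) {α : ℝ} (hα0 : 0 < α) (hα1 : α < 1) :
    ∃ β δ m : ℝ, 0 < β ∧ 0 < δ ∧ 0 < m ∧ ∀ (K : ℕ), 1 ≤ K → ∀ (ex : ℕ) (M : Fin (d + 1) → ℕ) [∀ μ, NeZero (M μ)], (∀ μ, M μ = 2 * L ^ ex) →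
      ∀ (msq : ℝ), 0 < msq → msq ≤ m0sq → ∀ (Msz : ℝ) (A' : Fin (d + 1) → Tor (fine L (fine (L ^ K) M)) → Matrix n n ℂ) (a₀ gA GA : ℝ),
      0 ≤ a₀ → 2 * a₀ ≤ 1 → 0 ≤ gA → 0 ≤ GA → (∀ μ y', ‖A' μ y'‖ ≤ a₀) →
      (∀ μ ν y', ‖A' μ y' - A' μ (y' - unitVec (fine L (fine (L ^ K) M)) ν)‖ ≤ ((L : ℝ) ^ (K + 1))⁻¹ * gA) →
      (∀ μ ν (z' : Tor (fine L (fine (L ^ K) M))), ‖(((L : ℝ) ^ (K + 1))⁻¹)⁻¹ • (A' μ (z' + unitVec (fine L (fine (L ^ K) M)) ν + unitVec (fine L (fine (L ^ K) M)) μ) -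
          A' μ (z' + unitVec (fine L (fine (L ^ K) M)) ν)) - (((L : ℝ) ^ (K + 1))⁻¹)⁻¹ • (A' μ (z' + unitVec (fine L (fine (L ^ K) M)) μ) - A' μ z')‖ ≤ ((L : ℝ) ^ (K + 1))⁻¹ * GA) →
      (∀ μ y', (A' μ y')ᴴ = -A' μ y') →
      β * (expRowLetter κ (Fin (d + 1)) (basisConst e) (2 * a₀) 0 (2 * gA) * (1 + Fintype.card (Fin (d + 1) ⊕ Fin (d + 1)))) * B4Sect5Proof.latticeConst (d + 1) (δ / 2) < 1 →
    HasMaj (BlockNorm.ofBlocks (unitTorusGeoS L K M Msz) (liftBlk (blockOf (L ^ K) M) κ)) (BlockNorm.ofBlocks (unitTorusGeoS L K M Msz) (blkPair (liftBlk (blockOf (L ^ K) M ∘ blockOf L (fine (L ^ K) M)) κ)))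
      (idef (pull (liftMap (blockOf L (fine (L ^ K) M)) κ)) (pull (liftPair (liftMap (blockOf L (fine (L ^ K) M)) κ)))
        (curvDressed ((L : ℝ) ^ (K + 1))⁻¹ (torStep (fine L (fine (L ^ K) M))) (expTrField e ((L : ℝ) ^ (K + 1))⁻¹ 0) (expTrField e ((L : ℝ) ^ (K + 1))⁻¹ (fun μ y' => adCLM ℝ (A' μ y'))) (kingGT₁ L a msq K M κ))
        (curvDressed ((L : ℝ) * ((L : ℝ) ^ (K + 1))⁻¹) (torStep (fine (L ^ K) M)) (expTrField e ((L : ℝ) * ((L : ℝ) ^ (K + 1))⁻¹) (blockMeanField L (fine (L ^ K) M) 0)) (expTrField e ((L : ℝ) * ((L : ℝ) ^ (K + 1))⁻¹) (blockMeanField L (fine (L ^ K) M) (fun μ y' => adCLM ℝ (A' μ y')))) (kingGT L a msq K M κ)))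
      (fun y y' => (m * (((L : ℝ) ^ K) ^ (-(γ / 2)) + ((L : ℝ) ^ K) ^ (-α)) * B4Sect5Proof.latticeConst (d + 1) (δ / 2) + 1 * (m * (((L : ℝ) ^ K) ^ (-(γ / 2)) + ((L : ℝ) ^ K) ^ (-α)) * B4Sect5Proof.latticeConst (d + 1) (δ / 2)) * (expRowLetter κ (Fin (d + 1)) (basisConst e) (2 * a₀) 0 (2 * gA) * (1 + Fintype.card (Fin (d + 1) ⊕ Fin (d + 1))) *
          (β * (1 - β * (expRowLetter κ (Fin (d + 1)) (basisConst e) (2 * a₀) 0 (2 * gA) * (1 + Fintype.card (Fin (d + 1) ⊕ Fin (d + 1)))) * B4Sect5Proof.latticeConst (d + 1) (δ / 2))⁻¹)) +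
          β * (expFitLetter κ (Fin (d + 1)) (basisConst e) (2 * a₀) 0 (2 * gA) (((d + 1 : ℕ) : ℝ) * ((L : ℝ) * ((L : ℝ) ^ (K + 1))⁻¹) * (2 * gA)) (((d + 1 : ℕ) : ℝ) * ((L : ℝ) * ((L : ℝ) ^ (K + 1))⁻¹) * (2 * gA) + (L : ℝ) * ((L : ℝ) ^ (K + 1))⁻¹ * (2 * gA))
              (((d + 1 : ℕ) : ℝ) * ((L : ℝ) * ((L : ℝ) ^ (K + 1))⁻¹) * 0 + (L : ℝ) * ((L : ℝ) ^ (K + 1))⁻¹ * 0) ((((d + 1 : ℕ) : ℝ) + 1) * ((L : ℝ) * ((L : ℝ) ^ (K + 1))⁻¹) * (2 * GA)) ((L : ℝ) * ((L : ℝ) ^ (K + 1))⁻¹) * (1 + Fintype.card (Fin (d + 1) ⊕ Fin (d + 1)))) *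
            (β * (1 - β * (expRowLetter κ (Fin (d + 1)) (basisConst e) (2 * a₀) 0 (2 * gA) * (1 + Fintype.card (Fin (d + 1) ⊕ Fin (d + 1)))) * B4Sect5Proof.latticeConst (d + 1) (δ / 2))⁻¹) * B4Sect5Proof.latticeConst (d + 1) (δ / 2)) *
        (1 - 1 * (β * (expRowLetter κ (Fin (d + 1)) (basisConst e) (2 * a₀) 0 (2 * gA) * (1 + Fintype.card (Fin (d + 1) ⊕ Fin (d + 1)))) * B4Sect5Proof.latticeConst (d + 1) (δ / 2)))⁻¹ * Real.exp (-(δ / 2 * tdistT M y y'))) := by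
  obtain ⟨β, δ, m, hβ, hδ, hm, H⟩ := hasMaj_idef_curvDressed_kingTorus_king_field (d := d) L hLodd hL ha hm0 hγ0 hγ1 hα0 hα1
  refine ⟨β, δ, m, hβ, hδ, hm, fun K hK ex M _ hM msq hmsq hcap Msz A' a₀ gA GA ha0 ha1 hgA hGA hA hgradA hsecA hAs hq => ?_⟩
  -- the generator-level letters READ OFF the potential's letters through `‖ad_X‖ ≤ 2‖X‖` and the linearity of `ad`; skewness from file 3
  have h2 : ∀ {X : Matrix n n ℂ} {c : ℝ}, ‖X‖ ≤ c → ‖adCLM ℝ X‖ ≤ 2 * c := fun hX => (norm_adCLM_le ℝ _).trans (mul_le_mul_of_nonneg_left hX two_pos.le)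
  have hZ' : ∀ μ y', ‖adCLM ℝ (A' μ y')‖ ≤ 2 * a₀ := fun μ y' => h2 (hA μ y')
  have hgrad' : ∀ μ ν y', ‖adCLM ℝ (A' μ y') - adCLM ℝ (A' μ (y' - unitVec (fine L (fine (L ^ K) M)) ν))‖ ≤ ((L : ℝ) ^ (K + 1))⁻¹ * (2 * gA) := fun μ ν y' => by
    rw [adCLM_sub, mul_left_comm]; exact h2 (hgradA μ ν y')
  have hsec' : ∀ μ ν (z' : Tor (fine L (fine (L ^ K) M))), ‖(((L : ℝ) ^ (K + 1))⁻¹)⁻¹ • (adCLM ℝ (A' μ (z' + unitVec (fine L (fine (L ^ K) M)) ν + unitVec (fine L (fine (L ^ K) M)) μ)) -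
      adCLM ℝ (A' μ (z' + unitVec (fine L (fine (L ^ K) M)) ν))) - (((L : ℝ) ^ (K + 1))⁻¹)⁻¹ • (adCLM ℝ (A' μ (z' + unitVec (fine L (fine (L ^ K) M)) μ)) - adCLM ℝ (A' μ z'))‖ ≤
      ((L : ℝ) ^ (K + 1))⁻¹ * (2 * GA) := fun μ ν z' => by
    rw [adCLM_sub, adCLM_sub, ← adCLM_smul, ← adCLM_smul, adCLM_sub, mul_left_comm]; exact h2 (hsecA μ ν z')
  have hZs' : ∀ μ y', (coordMat e (adCLM ℝ (A' μ y')))ᵀ = -coordMat e (adCLM ℝ (A' μ y')) := fun μ y' =>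
    coordMat_adCLM_transpose_eq_neg_of_conjTranspose e he (hAs μ y')
  exact H K hK ex M hM msq hmsq hcap Msz κ (Matrix n n ℂ) e (fun μ y' => adCLM ℝ (A' μ y')) (2 * a₀) (2 * gA) (2 * GA) (by positivity) ha1 (by positivity) (by positivity)
    hZ' hgrad' hsec' hZs' hq

end Adjoint

end Summit.QuantumFields.YangMills.BalabanUVNodes.N15.CurvedSpecies

end
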